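import Literature.Topology.FourManifolds.SurfaceGroupNielsenCoreSidesFix
import Literature.Topology.FourManifolds.SurfaceGroupNielsenCoreHalf
import HarnessLib

/-!
# Nielsen's theorem, pillar CORE: sides of a double point — Claim (A) and the interval lemmas

Topic `Literature/Topology/FourManifolds`.  Third part of layer F4b of the minimal-counterexample
form of Zieschang's homotopic shortening theorem (Zieschang–Vogt–Coldewey, LNM 835, proof of
Thm. 5.3.2 and Lemma 5.3.4: *"the chain of extreme letters cannot change sides"*), continuing
`SurfaceGroupNielsenCoreSidesAux.lean` and `SurfaceGroupNielsenCoreSidesFix.lean`.  Fix a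
potential-minimal configuration `κ` of an indecomposable, marked non-trivial assignment and a
double point `a < b` of its closed path; (P2) (no subloop separates a chain) is taken in
positional form as the hypothesis `hP2` (it is `kpos_mem_iff_of_chainEnd` of
`SurfaceGroupNielsenCoreSeparation.lean`).

* **The interval lemmas** (`succ_le_jc_bar`, `sub_le_jc_cpred_bar`): if the kernel slots of an
  occurrence `k` up to the slot `p` (resp. from the slot `p + 1` on) all have cancelled formal
  partners, then the successor of `k̄` cancels at least `p + 1` letters of `k̄` (resp. the
  predecessor of `k̄` cancels at least `n - 1 - p` letters) — the image of an interval of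
  kernel slots under the formal partner is an interval of slots of `k̄` avoiding its kernel, so
  it lies in the tail or in the head of `k̄`, the other alternative being a doubly
  half-cancelled symbol, excluded by `SurfaceGroupNielsenCoreHalf.lean` (P3).
* **Claim (A)** (`inside_iff_inside_bar`): the two occurrences of a symbol none of which is a
  portal lie on the same side; hence formal edges of non-portal symbols never cross
  (`not_fcross_of_not_portalAt`).
* **Portal symbols**: for the portal `k` at `a` (cut between the slots `slotAt k a - 1` and
  `slotAt k a`) with `k̄` inside, `slotAt k a ≤ jc k̄` and the crossing formal edges of the
  symbol are exactly those at the slots `(k, q)`, `q < slotAt k a`, their other endpoint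
  `(k̄, n - 1 - q)` being a TAIL slot (`fcross_iff_of_portalAt_left_of_inside`,
  `isTailSlot_of_portalAt_left_of_inside`); the three mirror images (`k̄` outside: head
  endpoints at `q ≥ slotAt k a`; the portal at `b` with `k̄` inside / outside).

All `SideIn`-statements carry the separation hypothesis
`hsep : ∀ j, ¬ (PortalAt a j ∧ PortalAt b j)` (the same-kernel case is settled separately).

## References

* H. Zieschang, E. Vogt, H.-D. Coldewey, *Surfaces and Planar Discontinuous Groups*, LNM 835
  (1980), proof of Thm. 5.3.2 and Lemma 5.3.4. [ZieschangVogtColdewey1980]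
-/

noncomputable section

namespace Literature.Topology.FourManifolds

open Literature.GroupTheory.CombinatorialGroupTheory List
open Literature.GroupTheory.CombinatorialGroupTheory.CycFactors (fac cpred jc kernel closedPath
  CycNielsen IsSlot IsHeadSlot IsTailSlot IsKernelSlot IsPairing cpartner cget fpartner kpos chainEnd)

namespace SurfaceGroup

namespace Config

variable {g : ℕ} {φ : surfaceGen g → SurfaceGroup g}

section Min

variable (κ : Config φ) (hg : 1 ≤ g) (hI : Indecomposable φ) (hM : MarkedNontrivial φ) (hmin : κ.IsMin)
include hg hI hM hmin

/-! ## The interval lemmas -/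

/-- **Interval lemma, pre-cut form.**  Let `k < m` carry the value `V`, `n = |V|`,
`c₁ = jc (k-1)`, and let `c₁ ≤ p`.  If the formal partners `(k̄, n - 1 - q)` of the kernel
slots `(k, q)`, `c₁ ≤ q ≤ p`, are all cancelled, then the successor of `k̄` cancels at least
`p + 1` letters: `p + 1 ≤ jc k̄` (so those partners are tail slots of `k̄`).  Indeed the
partners form the interval `[n - 1 - p, n - c₁)` of slots of `k̄` avoiding its kernel; lying in
the head would force `c₁ = jc (k̄ - 1) = n / 2`, a doubly half-cancelled symbol.
[cite: ZieschangVogtColdewey1980, proof of Thm. 5.3.2 and Lemma 5.3.4] -/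
theorem succ_le_jc_bar {k p : ℕ} (hk : k < κ.w.length) (hc₁ : jc κ.U (cpred κ.U k) ≤ p)
    (h : ∀ q, jc κ.U (cpred κ.U k) ≤ q → q ≤ p →
      ¬ IsKernelSlot κ.U (κ.bar k, (fac κ.U k).length - 1 - q)) :
    p + 1 ≤ jc κ.U (κ.bar k) := by
  have hN := κ.cycNielsen_U hg hI hM hmin
  have hU := κ.U_ne_nil hg
  have hb := κ.isPairing_bar
  have hkU : k < κ.U.length := by rw [length_U]; exact hk
  have hbk : κ.bar k < κ.U.length := hb.lt k hkU
  have hlen : (fac κ.U (κ.bar k)).length = (fac κ.U k).length := hb.length_fac_bar hkU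
  have hcc : jc κ.U (cpred κ.U k) + jc κ.U k < (fac κ.U k).length := hN.jc_add_jc_lt hU k
  have hdd : jc κ.U (cpred κ.U (κ.bar k)) + jc κ.U (κ.bar k) < (fac κ.U k).length := by
    have := hN.jc_add_jc_lt hU (κ.bar k)
    rwa [hlen] at this
  have h2c : 2 * jc κ.U (cpred κ.U k) ≤ (fac κ.U k).length := by
    have := (hN.pair (cpred κ.U k)).2
    rwa [CycFactors.fac_cpred_succ] at this
  have h2d : 2 * jc κ.U (cpred κ.U (κ.bar k)) ≤ (fac κ.U k).length := by
    have := (hN.pair (cpred κ.U (κ.bar k))).2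
    rwa [CycFactors.fac_cpred_succ, hlen] at this
  have hF3 := κ.not_both_first_halves hI hM hmin hk
  have havoid : ∀ p', (fac κ.U k).length - 1 - p ≤ p' → p' < (fac κ.U k).length - jc κ.U (cpred κ.U k) →
      p' < jc κ.U (cpred κ.U (κ.bar k)) ∨ (fac κ.U k).length - jc κ.U (κ.bar k) ≤ p' := by
    intro p' h1 h2
    have hq := h ((fac κ.U k).length - 1 - p') (by omega) (by omega)
    rw [show (fac κ.U k).length - 1 - ((fac κ.U k).length - 1 - p') = p' by omega] at hq
    unfold CycFactors.IsKernelSlot CycFactors.IsSlot at hq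
    dsimp only at hq
    omega
  rcases interval_avoid (by omega) (by omega) havoid with h' | h'
  · omega
  · omega

/-- **Interval lemma, post-cut form.**  Let `k < m` carry the value `V`, `n = |V|`,
`c₂ = jc k`, and let `p + 1 + c₂ < n`.  If the formal partners `(k̄, n - 1 - q)` of the kernel
slots `(k, q)`, `p + 1 ≤ q < n - c₂`, are all cancelled, then the predecessor of `k̄` cancels
at least `n - 1 - p` letters: `n - 1 - p ≤ jc (k̄ - 1)` (so those partners are head slots of
`k̄`); lying in the tail would force `c₂ = jc k̄ = n / 2`.
[cite: ZieschangVogtColdewey1980, proof of Thm. 5.3.2 and Lemma 5.3.4] -/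
theorem sub_le_jc_cpred_bar {k p : ℕ} (hk : k < κ.w.length)
    (hp : p + 1 + jc κ.U k < (fac κ.U k).length)
    (h : ∀ q, p + 1 ≤ q → q + jc κ.U k < (fac κ.U k).length →
      ¬ IsKernelSlot κ.U (κ.bar k, (fac κ.U k).length - 1 - q)) :
    (fac κ.U k).length - 1 - p ≤ jc κ.U (cpred κ.U (κ.bar k)) := by
  have hN := κ.cycNielsen_U hg hI hM hmin
  have hU := κ.U_ne_nil hg
  have hb := κ.isPairing_bar
  have hkU : k < κ.U.length := by rw [length_U]; exact hk
  have hbk : κ.bar k < κ.U.length := hb.lt k hkU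
  have hlen : (fac κ.U (κ.bar k)).length = (fac κ.U k).length := hb.length_fac_bar hkU
  have hdd : jc κ.U (cpred κ.U (κ.bar k)) + jc κ.U (κ.bar k) < (fac κ.U k).length := by
    have := hN.jc_add_jc_lt hU (κ.bar k)
    rwa [hlen] at this
  have h2c : 2 * jc κ.U k ≤ (fac κ.U k).length := (hN.pair k).1
  have h2d : 2 * jc κ.U (κ.bar k) ≤ (fac κ.U k).length := by
    have := (hN.pair (κ.bar k)).1
    rwa [hlen] at this
  have hF3 := κ.not_both_second_halves hI hM hmin hk
  have havoid : ∀ p', jc κ.U k ≤ p' → p' < (fac κ.U k).length - 1 - p →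
      p' < jc κ.U (cpred κ.U (κ.bar k)) ∨ (fac κ.U k).length - jc κ.U (κ.bar k) ≤ p' := by
    intro p' h1 h2
    have hq := h ((fac κ.U k).length - 1 - p') (by omega) (by omega)
    rw [show (fac κ.U k).length - 1 - ((fac κ.U k).length - 1 - p') = p' by omega] at hq
    unfold CycFactors.IsKernelSlot CycFactors.IsSlot at hq
    dsimp only at hq
    omega
  rcases interval_avoid (by omega) (by omega) havoid with h' | h'
  · exact h'
  · omega

/-! ## Claim (A): non-portal symbols are not separated -/

/-- **Claim (A), core**: it is impossible that an occurrence `k` is inside and its partner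
`k̄` outside — the formal partners of the kernel slots of `k` would all be cancelled slots of
`k̄` (a kernel partner is a separated length-two chain), forming the interval `[c₂, n - c₁)`
which avoids the kernel of `k̄` only for a doubly half-cancelled symbol.
[cite: ZieschangVogtColdewey1980, proof of Thm. 5.3.2 and Lemma 5.3.4] -/
theorem false_of_inside_of_outside_bar {a b : ℕ}
    (hP2 : ∀ σ : ℕ × ℕ, IsKernelSlot κ.U σ → σ.1 < κ.w.length →
      ((a ≤ kpos κ.U σ ∧ kpos κ.U σ < b) ↔
        (a ≤ kpos κ.U (chainEnd κ.U κ.bar σ) ∧ kpos κ.U (chainEnd κ.U κ.bar σ) < b)))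
    {k : ℕ} (hk : k < κ.w.length) (hin : κ.Inside a b k) (hout : κ.Outside a b (κ.bar k)) : False := by
  have hN := κ.cycNielsen_U hg hI hM hmin
  have hU := κ.U_ne_nil hg
  have hb := κ.isPairing_bar
  have hkU : k < κ.U.length := by rw [length_U]; exact hk
  have hlen : (fac κ.U (κ.bar k)).length = (fac κ.U k).length := hb.length_fac_bar hkU
  have hcc : jc κ.U (cpred κ.U k) + jc κ.U k < (fac κ.U k).length := hN.jc_add_jc_lt hU k
  have h2c : 2 * jc κ.U k ≤ (fac κ.U k).length := (hN.pair k).1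
  have h2d : 2 * jc κ.U (κ.bar k) ≤ (fac κ.U k).length := by
    have := (hN.pair (κ.bar k)).1
    rwa [hlen] at this
  have hF3 := κ.not_both_second_halves hI hM hmin hk
  have key := κ.succ_le_jc_bar hg hI hM hmin hk (p := (fac κ.U k).length - 1 - jc κ.U k)
    (by omega) (fun q hq1 hq2 hτ => ?_)
  · omega
  · have hσ : IsKernelSlot κ.U (k, q) :=
      ⟨⟨hkU, by dsimp only; omega⟩, by dsimp only; omega, by dsimp only; omega⟩
    exact κ.false_of_isKernelSlot_fpartner hP2 hσ hτ fun hiff =>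
      κ.kpos_not_mem_of_outside hτ hout (hiff.1 (κ.kpos_mem_of_inside hσ hin))

/-- **Claim (A)**: the two occurrences of a symbol none of which is a portal lie on the same
side of the subloop. [cite: ZieschangVogtColdewey1980, proof of Thm. 5.3.2 and Lemma 5.3.4] -/
theorem inside_iff_inside_bar {a b : ℕ}
    (hP2 : ∀ σ : ℕ × ℕ, IsKernelSlot κ.U σ → σ.1 < κ.w.length →
      ((a ≤ kpos κ.U σ ∧ kpos κ.U σ < b) ↔
        (a ≤ kpos κ.U (chainEnd κ.U κ.bar σ) ∧ kpos κ.U (chainEnd κ.U κ.bar σ) < b)))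
    {k : ℕ} (hk : k < κ.w.length) (ha : ¬ κ.PortalAt a k) (hb : ¬ κ.PortalAt b k)
    (ha' : ¬ κ.PortalAt a (κ.bar k)) (hb' : ¬ κ.PortalAt b (κ.bar k)) :
    κ.Inside a b k ↔ κ.Inside a b (κ.bar k) := by
  have hkb : κ.bar k < κ.w.length := κ.bar_lt hk
  constructor
  · intro hin
    rcases κ.inside_or_outside ha' hb' with h | h
    · exact h
    · exact (κ.false_of_inside_of_outside_bar hg hI hM hmin hP2 hk hin h).elim
  · intro hin
    rcases κ.inside_or_outside ha hb with h | h
    · exact h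
    · refine (κ.false_of_inside_of_outside_bar hg hI hM hmin hP2 hkb hin ?_).elim
      rwa [κ.bar_bar hk]

/-- **Claim (A), outside form**: for a non-portal symbol, one occurrence is outside iff the
other is. [cite: ZieschangVogtColdewey1980, proof of Thm. 5.3.2 and Lemma 5.3.4] -/
theorem outside_iff_outside_bar {a b : ℕ}
    (hP2 : ∀ σ : ℕ × ℕ, IsKernelSlot κ.U σ → σ.1 < κ.w.length →
      ((a ≤ kpos κ.U σ ∧ kpos κ.U σ < b) ↔
        (a ≤ kpos κ.U (chainEnd κ.U κ.bar σ) ∧ kpos κ.U (chainEnd κ.U κ.bar σ) < b)))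
    {k : ℕ} (hk : k < κ.w.length) (ha : ¬ κ.PortalAt a k) (hb : ¬ κ.PortalAt b k)
    (ha' : ¬ κ.PortalAt a (κ.bar k)) (hb' : ¬ κ.PortalAt b (κ.bar k)) :
    κ.Outside a b k ↔ κ.Outside a b (κ.bar k) := by
  have key := κ.inside_iff_inside_bar hg hI hM hmin hP2 hk ha hb ha' hb'
  constructor
  · intro hout
    rcases κ.inside_or_outside ha' hb' with h | h
    · exact (κ.not_outside_of_inside hg hI hM hmin (key.2 h) hout).elim
    · exact h
  · intro hout
    rcases κ.inside_or_outside ha hb with h | h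
    · exact (κ.not_outside_of_inside hg hI hM hmin (key.1 h) hout).elim
    · exact h

/-- **Formal edges of non-portal symbols never cross the fixation** (Claim (A) for slots).
[cite: ZieschangVogtColdewey1980, Lemma 5.3.4] -/
theorem not_fcross_of_not_portalAt {a b : ℕ}
    (hP2 : ∀ σ : ℕ × ℕ, IsKernelSlot κ.U σ → σ.1 < κ.w.length →
      ((a ≤ kpos κ.U σ ∧ kpos κ.U σ < b) ↔
        (a ≤ kpos κ.U (chainEnd κ.U κ.bar σ) ∧ kpos κ.U (chainEnd κ.U κ.bar σ) < b)))
    {σ : ℕ × ℕ} (hσ : IsSlot κ.U σ) (ha : ¬ κ.PortalAt a σ.1) (hb : ¬ κ.PortalAt b σ.1)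
    (ha' : ¬ κ.PortalAt a (κ.bar σ.1)) (hb' : ¬ κ.PortalAt b (κ.bar σ.1)) :
    ¬ κ.FCross a b σ := by
  have hm : σ.1 < κ.w.length := by rw [← length_U]; exact hσ.1
  unfold FCross
  rw [κ.sideIn_iff_inside ha hb, κ.sideIn_iff_inside (σ := fpartner κ.U κ.bar σ) ha' hb', not_not]
  exact κ.inside_iff_inside_bar hg hI hM hmin hP2 hm ha hb ha' hb'

/-- **Crossing formal edges belong to portal symbols**: if the formal edge at a slot crosses
the fixation then one of the two occurrences of its symbol is a portal at one of the cuts.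
[cite: ZieschangVogtColdewey1980, Lemma 5.3.4] -/
theorem exists_portalAt_of_fcross {a b : ℕ}
    (hP2 : ∀ σ : ℕ × ℕ, IsKernelSlot κ.U σ → σ.1 < κ.w.length →
      ((a ≤ kpos κ.U σ ∧ kpos κ.U σ < b) ↔
        (a ≤ kpos κ.U (chainEnd κ.U κ.bar σ) ∧ kpos κ.U (chainEnd κ.U κ.bar σ) < b)))
    {σ : ℕ × ℕ} (hσ : IsSlot κ.U σ) (h : κ.FCross a b σ) :
    κ.PortalAt a σ.1 ∨ κ.PortalAt b σ.1 ∨ κ.PortalAt a (κ.bar σ.1) ∨ κ.PortalAt b (κ.bar σ.1) := by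
  by_contra hne
  simp only [not_or] at hne
  obtain ⟨h1, h2, h3, h4⟩ := hne
  exact κ.not_fcross_of_not_portalAt hg hI hM hmin hP2 hσ h1 h2 h3 h4 h

/-! ## Portal symbols: interval lemmas -/

/-- **Portal at `a`, partner inside**: the successor of `k̄` cancels at least `slotAt k a`
letters of `k̄`, i.e. the formal partners of the pre-cut slots `(k, q)`, `q < slotAt k a`, are
tail slots of `k̄` (the pre-cut kernel slots are outside, `k̄` is inside, and a kernel partner
would be a separated chain). [cite: ZieschangVogtColdewey1980, proof of Thm. 5.3.2 and Lemma 5.3.4] -/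
theorem slotAt_le_jc_bar_of_portalAt_left_of_inside {a b : ℕ}
    (hP2 : ∀ σ : ℕ × ℕ, IsKernelSlot κ.U σ → σ.1 < κ.w.length →
      ((a ≤ kpos κ.U σ ∧ kpos κ.U σ < b) ↔
        (a ≤ kpos κ.U (chainEnd κ.U κ.bar σ) ∧ kpos κ.U (chainEnd κ.U κ.bar σ) < b)))
    {k : ℕ} (hk : k < κ.w.length) (hpk : κ.PortalAt a k) (hin : κ.Inside a b (κ.bar k)) :
    κ.slotAt k a ≤ jc κ.U (κ.bar k) := by
  have hkU : k < κ.U.length := by rw [length_U]; exact hk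
  obtain ⟨hs1, hs2⟩ := κ.slotAt_bounds_of_portalAt hg hI hM hmin hpk
  have key := κ.succ_le_jc_bar hg hI hM hmin hk (p := κ.slotAt k a - 1) (by omega)
    (fun q hq1 hq2 hτ => ?_)
  · omega
  · have hσ : IsKernelSlot κ.U (k, q) :=
      ⟨⟨hkU, by dsimp only; omega⟩, by dsimp only; omega, by dsimp only; omega⟩
    refine κ.false_of_isKernelSlot_fpartner hP2 hσ hτ fun hiff => ?_
    have h1 := (hiff.2 (κ.kpos_mem_of_inside hτ hin)).1
    have h2 := (κ.kernelSlot_arith hσ).2.2.1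
    dsimp only at h2
    unfold PortalAt at hpk
    unfold slotAt at hq2
    omega

/-- **Portal at `a`, partner outside**: the predecessor of `k̄` cancels at least
`n - slotAt k a` letters of `k̄`, i.e. the formal partners of the post-cut slots `(k, q)`,
`slotAt k a ≤ q`, are head slots of `k̄`. [cite: ZieschangVogtColdewey1980, proof of Thm. 5.3.2 and Lemma 5.3.4] -/
theorem sub_slotAt_le_jc_cpred_bar_of_portalAt_left_of_outside {a b : ℕ} (hab : a < b)
    (hsep : ∀ j, ¬ (κ.PortalAt a j ∧ κ.PortalAt b j))
    (hP2 : ∀ σ : ℕ × ℕ, IsKernelSlot κ.U σ → σ.1 < κ.w.length →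
      ((a ≤ kpos κ.U σ ∧ kpos κ.U σ < b) ↔
        (a ≤ kpos κ.U (chainEnd κ.U κ.bar σ) ∧ kpos κ.U (chainEnd κ.U κ.bar σ) < b)))
    {k : ℕ} (hk : k < κ.w.length) (hpk : κ.PortalAt a k) (hout : κ.Outside a b (κ.bar k)) :
    (fac κ.U k).length - κ.slotAt k a ≤ jc κ.U (cpred κ.U (κ.bar k)) := by
  have hkU : k < κ.U.length := by rw [length_U]; exact hk
  obtain ⟨hs1, hs2⟩ := κ.slotAt_bounds_of_portalAt hg hI hM hmin hpk
  have hnb := hsep k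
  have key := κ.sub_le_jc_cpred_bar hg hI hM hmin hk (p := κ.slotAt k a - 1) (by omega)
    (fun q hq1 hq2 hτ => ?_)
  · omega
  · have hσ : IsKernelSlot κ.U (k, q) :=
      ⟨⟨hkU, by dsimp only; omega⟩, by dsimp only; omega, by dsimp only; omega⟩
    refine κ.false_of_isKernelSlot_fpartner hP2 hσ hτ fun hiff => ?_
    refine κ.kpos_not_mem_of_outside hτ hout (hiff.1 ?_)
    obtain ⟨-, -, h2, h3⟩ := κ.kernelSlot_arith hσ
    dsimp only at h2 h3
    unfold PortalAt at hpk hnb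
    unfold slotAt at hq1
    omega

/-- **Portal at `b`, partner inside**: the predecessor of `k̄` cancels at least
`n - slotAt k b` letters of `k̄`, i.e. the formal partners of the post-cut slots `(k, q)`,
`slotAt k b ≤ q` (which are outside), are head slots of `k̄`.
[cite: ZieschangVogtColdewey1980, proof of Thm. 5.3.2 and Lemma 5.3.4] -/
theorem sub_slotAt_le_jc_cpred_bar_of_portalAt_right_of_inside {a b : ℕ}
    (hP2 : ∀ σ : ℕ × ℕ, IsKernelSlot κ.U σ → σ.1 < κ.w.length →
      ((a ≤ kpos κ.U σ ∧ kpos κ.U σ < b) ↔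
        (a ≤ kpos κ.U (chainEnd κ.U κ.bar σ) ∧ kpos κ.U (chainEnd κ.U κ.bar σ) < b)))
    {k : ℕ} (hk : k < κ.w.length) (hpk : κ.PortalAt b k) (hin : κ.Inside a b (κ.bar k)) :
    (fac κ.U k).length - κ.slotAt k b ≤ jc κ.U (cpred κ.U (κ.bar k)) := by
  have hkU : k < κ.U.length := by rw [length_U]; exact hk
  obtain ⟨hs1, hs2⟩ := κ.slotAt_bounds_of_portalAt hg hI hM hmin hpk
  have key := κ.sub_le_jc_cpred_bar hg hI hM hmin hk (p := κ.slotAt k b - 1) (by omega)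
    (fun q hq1 hq2 hτ => ?_)
  · omega
  · have hσ : IsKernelSlot κ.U (k, q) :=
      ⟨⟨hkU, by dsimp only; omega⟩, by dsimp only; omega, by dsimp only; omega⟩
    refine κ.false_of_isKernelSlot_fpartner hP2 hσ hτ fun hiff => ?_
    have h1 := (hiff.2 (κ.kpos_mem_of_inside hτ hin)).2
    have h2 := (κ.kernelSlot_arith hσ).2.2.1
    dsimp only at h2
    unfold PortalAt at hpk
    unfold slotAt at hq1
    omega

/-- **Portal at `b`, partner outside**: the successor of `k̄` cancels at least `slotAt k b`
letters of `k̄`, i.e. the formal partners of the pre-cut slots `(k, q)`, `q < slotAt k b`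
(which are inside), are tail slots of `k̄`. [cite: ZieschangVogtColdewey1980, proof of Thm. 5.3.2 and Lemma 5.3.4] -/
theorem slotAt_le_jc_bar_of_portalAt_right_of_outside {a b : ℕ} (hab : a < b)
    (hsep : ∀ j, ¬ (κ.PortalAt a j ∧ κ.PortalAt b j))
    (hP2 : ∀ σ : ℕ × ℕ, IsKernelSlot κ.U σ → σ.1 < κ.w.length →
      ((a ≤ kpos κ.U σ ∧ kpos κ.U σ < b) ↔
        (a ≤ kpos κ.U (chainEnd κ.U κ.bar σ) ∧ kpos κ.U (chainEnd κ.U κ.bar σ) < b)))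
    {k : ℕ} (hk : k < κ.w.length) (hpk : κ.PortalAt b k) (hout : κ.Outside a b (κ.bar k)) :
    κ.slotAt k b ≤ jc κ.U (κ.bar k) := by
  have hkU : k < κ.U.length := by rw [length_U]; exact hk
  obtain ⟨hs1, hs2⟩ := κ.slotAt_bounds_of_portalAt hg hI hM hmin hpk
  have hna := hsep k
  have key := κ.succ_le_jc_bar hg hI hM hmin hk (p := κ.slotAt k b - 1) (by omega)
    (fun q hq1 hq2 hτ => ?_)
  · omega
  · have hσ : IsKernelSlot κ.U (k, q) :=
      ⟨⟨hkU, by dsimp only; omega⟩, by dsimp only; omega, by dsimp only; omega⟩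
    refine κ.false_of_isKernelSlot_fpartner hP2 hσ hτ fun hiff => ?_
    refine κ.kpos_not_mem_of_outside hτ hout (hiff.1 ?_)
    obtain ⟨-, -, h2, h3⟩ := κ.kernelSlot_arith hσ
    dsimp only at h2 h3
    unfold PortalAt at hpk hna
    unfold slotAt at hq2
    omega

/-! ## Portal symbols: the crossing formal edges -/

omit hg hI hM hmin in
/-- **Crossing formal edges of the portal at `a` with inside partner**: exactly the edges at
the pre-cut slots `(k, q)`, `q < slotAt k a`. [cite: ZieschangVogtColdewey1980, Lemma 5.3.4] -/
theorem fcross_iff_of_portalAt_left_of_inside {a b : ℕ}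
    (hsep : ∀ j, ¬ (κ.PortalAt a j ∧ κ.PortalAt b j)) {k : ℕ} (hpk : κ.PortalAt a k)
    (hin : κ.Inside a b (κ.bar k)) (q : ℕ) :
    κ.FCross a b (k, q) ↔ q < κ.slotAt k a := by
  have hnb : ¬ κ.PortalAt b k := fun h => hsep k ⟨hpk, h⟩
  have hni : ¬ κ.Inside a b k := fun h => κ.not_portalAt_left_of_inside h hpk
  have h1 : κ.SideIn a b (fpartner κ.U κ.bar (k, q)) := Or.inl hin
  have h2 : κ.SideIn a b (k, q) ↔ κ.slotAt k a ≤ q := by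
    simp only [SideIn, hni, hpk, hnb, true_and, false_and, false_or, or_false]
  unfold FCross
  rw [h2, iff_true_right h1, not_le]

/-- **Crossing formal edges of the portal at `a` with outside partner**: exactly the edges at
the post-cut slots `(k, q)`, `slotAt k a ≤ q`. [cite: ZieschangVogtColdewey1980, Lemma 5.3.4] -/
theorem fcross_iff_of_portalAt_left_of_outside {a b : ℕ} (hab : a < b)
    (hsep : ∀ j, ¬ (κ.PortalAt a j ∧ κ.PortalAt b j)) {k : ℕ} (hpk : κ.PortalAt a k)
    (hout : κ.Outside a b (κ.bar k)) (q : ℕ) :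
    κ.FCross a b (k, q) ↔ κ.slotAt k a ≤ q := by
  have hnb : ¬ κ.PortalAt b k := fun h => hsep k ⟨hpk, h⟩
  have hni : ¬ κ.Inside a b k := fun h => κ.not_portalAt_left_of_inside h hpk
  have h1 : ¬ κ.SideIn a b (fpartner κ.U κ.bar (k, q)) := by
    rw [κ.sideIn_iff_inside (σ := fpartner κ.U κ.bar (k, q))
      (κ.not_portalAt_left_of_outside hab hout) (κ.not_portalAt_right_of_outside hab hout)]
    exact fun h => κ.not_outside_of_inside hg hI hM hmin h hout
  have h2 : κ.SideIn a b (k, q) ↔ κ.slotAt k a ≤ q := by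
    simp only [SideIn, hni, hpk, hnb, true_and, false_and, false_or, or_false]
  unfold FCross
  rw [h2, iff_false_right h1, not_not]

omit hg hI hM hmin in
/-- **Crossing formal edges of the portal at `b` with inside partner**: exactly the edges at
the post-cut slots `(k, q)`, `slotAt k b ≤ q`. [cite: ZieschangVogtColdewey1980, Lemma 5.3.4] -/
theorem fcross_iff_of_portalAt_right_of_inside {a b : ℕ}
    (hsep : ∀ j, ¬ (κ.PortalAt a j ∧ κ.PortalAt b j)) {k : ℕ} (hpk : κ.PortalAt b k)
    (hin : κ.Inside a b (κ.bar k)) (q : ℕ) :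
    κ.FCross a b (k, q) ↔ κ.slotAt k b ≤ q := by
  have hna : ¬ κ.PortalAt a k := fun h => hsep k ⟨h, hpk⟩
  have hni : ¬ κ.Inside a b k := fun h => κ.not_portalAt_right_of_inside h hpk
  have h1 : κ.SideIn a b (fpartner κ.U κ.bar (k, q)) := Or.inl hin
  have h2 : κ.SideIn a b (k, q) ↔ q < κ.slotAt k b := by
    simp only [SideIn, hni, hpk, hna, true_and, false_and, false_or]
  unfold FCross
  rw [h2, iff_true_right h1, not_lt]

/-- **Crossing formal edges of the portal at `b` with outside partner**: exactly the edges at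
the pre-cut slots `(k, q)`, `q < slotAt k b`. [cite: ZieschangVogtColdewey1980, Lemma 5.3.4] -/
theorem fcross_iff_of_portalAt_right_of_outside {a b : ℕ} (hab : a < b)
    (hsep : ∀ j, ¬ (κ.PortalAt a j ∧ κ.PortalAt b j)) {k : ℕ} (hpk : κ.PortalAt b k)
    (hout : κ.Outside a b (κ.bar k)) (q : ℕ) :
    κ.FCross a b (k, q) ↔ q < κ.slotAt k b := by
  have hna : ¬ κ.PortalAt a k := fun h => hsep k ⟨h, hpk⟩
  have hni : ¬ κ.Inside a b k := fun h => κ.not_portalAt_right_of_inside h hpk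
  have h1 : ¬ κ.SideIn a b (fpartner κ.U κ.bar (k, q)) := by
    rw [κ.sideIn_iff_inside (σ := fpartner κ.U κ.bar (k, q))
      (κ.not_portalAt_left_of_outside hab hout) (κ.not_portalAt_right_of_outside hab hout)]
    exact fun h => κ.not_outside_of_inside hg hI hM hmin h hout
  have h2 : κ.SideIn a b (k, q) ↔ q < κ.slotAt k b := by
    simp only [SideIn, hni, hpk, hna, true_and, false_and, false_or]
  unfold FCross
  rw [h2, iff_false_right h1, not_not]

/-- The crossing formal edges of the portal at `a` with inside partner end in TAIL slots of
`k̄`: for `q < slotAt k a` the partner `(k̄, n - 1 - q)` is a tail slot (at depth `q`).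
[cite: ZieschangVogtColdewey1980, Lemma 5.3.4] -/
theorem isTailSlot_of_portalAt_left_of_inside {a b : ℕ}
    (hP2 : ∀ σ : ℕ × ℕ, IsKernelSlot κ.U σ → σ.1 < κ.w.length →
      ((a ≤ kpos κ.U σ ∧ kpos κ.U σ < b) ↔
        (a ≤ kpos κ.U (chainEnd κ.U κ.bar σ) ∧ kpos κ.U (chainEnd κ.U κ.bar σ) < b)))
    {k : ℕ} (hk : k < κ.w.length) (hpk : κ.PortalAt a k) (hin : κ.Inside a b (κ.bar k))
    {q : ℕ} (hq : q < κ.slotAt k a) :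
    IsTailSlot κ.U (κ.bar k, (fac κ.U k).length - 1 - q) := by
  have key := κ.slotAt_le_jc_bar_of_portalAt_left_of_inside hg hI hM hmin hP2 hk hpk hin
  obtain ⟨-, hs2⟩ := κ.slotAt_bounds_of_portalAt hg hI hM hmin hpk
  have hkU : k < κ.U.length := by rw [length_U]; exact hk
  have hlen : (fac κ.U (κ.bar k)).length = (fac κ.U k).length := κ.isPairing_bar.length_fac_bar hkU
  refine ⟨⟨κ.isPairing_bar.lt k hkU, ?_⟩, ?_⟩ <;> dsimp only <;> rw [hlen] <;> omega

/-- The crossing formal edges of the portal at `a` with outside partner end in HEAD slots of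
`k̄`: for `slotAt k a ≤ q < n` the partner `(k̄, n - 1 - q)` is a head slot (at position
`n - 1 - q`). [cite: ZieschangVogtColdewey1980, Lemma 5.3.4] -/
theorem isHeadSlot_of_portalAt_left_of_outside {a b : ℕ} (hab : a < b)
    (hsep : ∀ j, ¬ (κ.PortalAt a j ∧ κ.PortalAt b j))
    (hP2 : ∀ σ : ℕ × ℕ, IsKernelSlot κ.U σ → σ.1 < κ.w.length →
      ((a ≤ kpos κ.U σ ∧ kpos κ.U σ < b) ↔
        (a ≤ kpos κ.U (chainEnd κ.U κ.bar σ) ∧ kpos κ.U (chainEnd κ.U κ.bar σ) < b)))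
    {k : ℕ} (hk : k < κ.w.length) (hpk : κ.PortalAt a k) (hout : κ.Outside a b (κ.bar k))
    {q : ℕ} (hq : κ.slotAt k a ≤ q) (hqn : q < (fac κ.U k).length) :
    IsHeadSlot κ.U (κ.bar k, (fac κ.U k).length - 1 - q) := by
  have key := κ.sub_slotAt_le_jc_cpred_bar_of_portalAt_left_of_outside hg hI hM hmin hab hsep hP2 hk hpk hout
  have hkU : k < κ.U.length := by rw [length_U]; exact hk
  have hlen : (fac κ.U (κ.bar k)).length = (fac κ.U k).length := κ.isPairing_bar.length_fac_bar hkU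
  refine ⟨⟨κ.isPairing_bar.lt k hkU, ?_⟩, ?_⟩ <;> dsimp only
  · rw [hlen]; omega
  · omega

/-- The crossing formal edges of the portal at `b` with inside partner end in HEAD slots of
`k̄`: for `slotAt k b ≤ q < n` the partner `(k̄, n - 1 - q)` is a head slot.
[cite: ZieschangVogtColdewey1980, Lemma 5.3.4] -/
theorem isHeadSlot_of_portalAt_right_of_inside {a b : ℕ}
    (hP2 : ∀ σ : ℕ × ℕ, IsKernelSlot κ.U σ → σ.1 < κ.w.length →
      ((a ≤ kpos κ.U σ ∧ kpos κ.U σ < b) ↔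
        (a ≤ kpos κ.U (chainEnd κ.U κ.bar σ) ∧ kpos κ.U (chainEnd κ.U κ.bar σ) < b)))
    {k : ℕ} (hk : k < κ.w.length) (hpk : κ.PortalAt b k) (hin : κ.Inside a b (κ.bar k))
    {q : ℕ} (hq : κ.slotAt k b ≤ q) (hqn : q < (fac κ.U k).length) :
    IsHeadSlot κ.U (κ.bar k, (fac κ.U k).length - 1 - q) := by
  have key := κ.sub_slotAt_le_jc_cpred_bar_of_portalAt_right_of_inside hg hI hM hmin hP2 hk hpk hin
  have hkU : k < κ.U.length := by rw [length_U]; exact hk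
  have hlen : (fac κ.U (κ.bar k)).length = (fac κ.U k).length := κ.isPairing_bar.length_fac_bar hkU
  refine ⟨⟨κ.isPairing_bar.lt k hkU, ?_⟩, ?_⟩ <;> dsimp only
  · rw [hlen]; omega
  · omega

/-- The crossing formal edges of the portal at `b` with outside partner end in TAIL slots of
`k̄`: for `q < slotAt k b` the partner `(k̄, n - 1 - q)` is a tail slot (at depth `q`).
[cite: ZieschangVogtColdewey1980, Lemma 5.3.4] -/
theorem isTailSlot_of_portalAt_right_of_outside {a b : ℕ} (hab : a < b)
    (hsep : ∀ j, ¬ (κ.PortalAt a j ∧ κ.PortalAt b j))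
    (hP2 : ∀ σ : ℕ × ℕ, IsKernelSlot κ.U σ → σ.1 < κ.w.length →
      ((a ≤ kpos κ.U σ ∧ kpos κ.U σ < b) ↔
        (a ≤ kpos κ.U (chainEnd κ.U κ.bar σ) ∧ kpos κ.U (chainEnd κ.U κ.bar σ) < b)))
    {k : ℕ} (hk : k < κ.w.length) (hpk : κ.PortalAt b k) (hout : κ.Outside a b (κ.bar k))
    {q : ℕ} (hq : q < κ.slotAt k b) :
    IsTailSlot κ.U (κ.bar k, (fac κ.U k).length - 1 - q) := by
  have key := κ.slotAt_le_jc_bar_of_portalAt_right_of_outside hg hI hM hmin hab hsep hP2 hk hpk hout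
  obtain ⟨-, hs2⟩ := κ.slotAt_bounds_of_portalAt hg hI hM hmin hpk
  have hkU : k < κ.U.length := by rw [length_U]; exact hk
  have hlen : (fac κ.U (κ.bar k)).length = (fac κ.U k).length := κ.isPairing_bar.length_fac_bar hkU
  refine ⟨⟨κ.isPairing_bar.lt k hkU, ?_⟩, ?_⟩ <;> dsimp only <;> rw [hlen] <;> omega

end Min

end Config

end SurfaceGroup

end Literature.Topology.FourManifolds

end
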